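import Summits.BirchSwinnertonDyer.BirchSwinnertonDyer.Theorems.ManinLocalTwoThreeStevensNaturalTes75
import Summits.BirchSwinnertonDyer.BirchSwinnertonDyer.Theorems.EdixhovenFibreFiveSevenStarredOptimalManinUnitFiveSevenCdtThm1
import HarnessLib

set_option autoImplicit false
-- the sub-problem namespace `Summit.BirchSwinnertonDyer.BirchSwinnertonDyer` duplicates a component by design (D-0017)
set_option linter.dupNamespace false

/-!
# Abbes–Ullmo 1996 Thm. A and Česnavičius 2018 Thm. 1.2 (case `2 ∥ N`) as tree theorems; support items
# `AbbesUllmoManinConstantGoodPrimes` (stmt-BirchSwinnertonDyer-20090) and `CesnaviciusManinConstantAtTwo`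
# (stmt-BirchSwinnertonDyer-20091) closed by name

Two statement-only (cite-only) Literature facts in lattice rendering (globally minimal `W'/ℚ`, lattice-optimal `X₀(N')`-datum `D'`,
`Λ_{W'} = c · Λ₀(f)`):

* `abbesUllmo_not_dvd_maninConstant_of_not_dvd_level` [AbbesUllmo1996, Thm. A]: `p ∤ N' ⟹ p ∤ c`;
* `cesnavicius_not_two_dvd_maninConstant_of_two_dvd_level` [Cesnavicius2018, Thm. 1.2]: `2 ∥ N' ⟹ 2 ∤ c`.

THE ROAD (all in the tree, cell bsd-f2-manin).  `ManinLocalTwoThree.StevensGalois.abbesUllmo_and_cesnavicius_of_CDT : CDT → AU ∧ Č`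
(`Theorems/ManinLocalTwoThreeStevensNaturalTes75.lean`): odd `p` by Stevens' inclusion `Λ₁(f) ⊆ Λ_W` ⟸ the Unbounded Denominators theorem
and the conjugation obstruction (`KummerValues.not_dvd_maninConstant_of_CDT`); the prime `2` by the half-index analysis — `2 ∣ c₀` puts
`Λ₁(f) ⊆ 2Λ₀(f)`, THEOREM K's Kummer values there from Stevens 1982 Thm. 1.3.1 (b) WITHOUT optimality (`StevensGalois.naturalTes75_holds`,
UNCONDITIONAL, p766724 lineage) and PROPOSITION A force `2⁵ ∣ N` (`NaturalTes75.two_pow_five_dvd_of_two_dvd_maninConstant_natural`),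
contradicting `2 ∤ N` resp. `2 ∥ N`.  The one remaining hypothesis, [CalegariDimitrovTang2025, Thm. 1.0.1], is the tree theorem
`calegariDimitrovTang2025_unboundedDenominators_holds` (line `cdt_thm1` of crux K★ stmt-BirchSwinnertonDyer-22226).

DEPENDENCY / WORDING OF RECORD (director-bsd (848)(C), (849)(1)(4)).  Every theorem here rests on the in-tree term
`calegariDimitrovTang2025_unboundedDenominators_holds` — UDC-dependent; audit (P†) pending; «kernel-closed (UDC-dependent, audit pending)»,
never «unconditional».  AS-TYPED vs PRINT: the two `_holds` statements are «=» print (lattice renderings, weaker than the sources); the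
road's intermediate `2 ∣ c₀ ⟹ 2⁵ ∣ N` at every level is «⊋ print».  Manin's conjecture is NOT proved here (the leaf `ManinConstantOne` and the
rung `ManinConstantOneRung` stay modulo modularity `exists_isNewformOf`: `maninLocalTwoThree_maninConstantOneRung_of_CDT_of_modularity`); BSD is
not proved by this; nothing here is an announcement.
[cite: AbbesUllmo1996, Thm. A] [cite: Cesnavicius2018, Thm. 1.2] [cite: CalegariDimitrovTang2025, Thm. 1.0.1] [cite: Stevens1982, §1.3 Thm. 1.3.1 (b)]
-/

noncomputable section

open Literature.NumberTheory.EllipticCurves Literature.NumberTheory.EllipticCurves.ModularForms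
open Literature.NumberTheory.Automorphic

namespace Summit.BirchSwinnertonDyer.BirchSwinnertonDyer.Theorems

/-- **Abbes–Ullmo 1996, Thm. A holds** (the Literature named fact `abbesUllmo_not_dvd_maninConstant_of_not_dvd_level`, lattice
rendering): for a globally minimal `W'/ℚ`, a lattice-optimal `X₀(N')`-datum and a prime `p ∤ N'`, `p ∤ c`.  From
`StevensGalois.abbesUllmo_and_cesnavicius_of_CDT` on the in-tree UDC term (UDC-dependent; audit (P†) pending).
[cite: AbbesUllmo1996, Thm. A] [cite: CalegariDimitrovTang2025, Thm. 1.0.1] [cite: Stevens1982, §1.3 Thm. 1.3.1 (b)] -/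
theorem abbesUllmo_not_dvd_maninConstant_of_not_dvd_level_holds : abbesUllmo_not_dvd_maninConstant_of_not_dvd_level :=
  (ManinLocalTwoThree.StevensGalois.abbesUllmo_and_cesnavicius_of_CDT
    calegariDimitrovTang2025_unboundedDenominators_holds).1

/-- **Česnavičius 2018, Thm. 1.2, case `2 ∥ N`, holds** (the Literature named fact
`cesnavicius_not_two_dvd_maninConstant_of_two_dvd_level`, lattice rendering): for a globally minimal `W'/ℚ` and a lattice-optimal
`X₀(N')`-datum with `2 ∣ N'`, `4 ∤ N'`: `2 ∤ c`.  From `StevensGalois.abbesUllmo_and_cesnavicius_of_CDT` on the in-tree UDC term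
(UDC-dependent; audit (P†) pending). [cite: Cesnavicius2018, Thm. 1.2] [cite: CalegariDimitrovTang2025, Thm. 1.0.1] [cite: Stevens1982, §1.3 Thm. 1.3.1 (b)] -/
theorem cesnavicius_not_two_dvd_maninConstant_of_two_dvd_level_holds :
    cesnavicius_not_two_dvd_maninConstant_of_two_dvd_level :=
  (ManinLocalTwoThree.StevensGalois.abbesUllmo_and_cesnavicius_of_CDT
    calegariDimitrovTang2025_unboundedDenominators_holds).2

/-- **Support item `AbbesUllmoManinConstantGoodPrimes` (stmt-BirchSwinnertonDyer-20090), proved by name** through route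
ManinLocalTwoThree's declaration (shared with routes BiquadraticEisensteinDescent, AdditiveKolyvaginRoad, ShiftedKolyvaginAtInertTwo).
UDC-dependent; audit (P†) pending; BSD is NOT proved by this. [cite: AbbesUllmo1996, Thm. A] [cite: CalegariDimitrovTang2025, Thm. 1.0.1] -/
theorem ManinLocalTwoThree.AbbesUllmoManinConstantGoodPrimes_proof :
    Summit.BirchSwinnertonDyer.BirchSwinnertonDyer.Theses.ManinLocalTwoThree.AbbesUllmoManinConstantGoodPrimes :=
  abbesUllmo_not_dvd_maninConstant_of_not_dvd_level_holds

/-- **Support item `CesnaviciusManinConstantAtTwo` (stmt-BirchSwinnertonDyer-20091), proved by name** through route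
ManinLocalTwoThree's declaration (shared with routes BiquadraticEisensteinDescent, AdditiveKolyvaginRoad, ShiftedKolyvaginAtInertTwo).
UDC-dependent; audit (P†) pending; BSD is NOT proved by this. [cite: Cesnavicius2018, Thm. 1.2] [cite: CalegariDimitrovTang2025, Thm. 1.0.1] -/
theorem ManinLocalTwoThree.CesnaviciusManinConstantAtTwo_proof :
    Summit.BirchSwinnertonDyer.BirchSwinnertonDyer.Theses.ManinLocalTwoThree.CesnaviciusManinConstantAtTwo :=
  cesnavicius_not_two_dvd_maninConstant_of_two_dvd_level_holds

end Summit.BirchSwinnertonDyer.BirchSwinnertonDyer.Theorems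

end
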